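import Summits.Ventures.PercRepro.RankLevelSetLevelFiveArithB

/-!
# PercRepro — S2: THE FLAT-TAIL BOUNDS — `64·(flat tail + spanning tail) ≤ 2^n`, and the `63/64` assembly lemma
(p7, gen 2; sub-claim S2, the flat-tail chain `P(5) = 53`)

With `S2FlatTail` the sets of rank `≤ 5` of the `e`-free core number at most
`Fl(n) := C(n,5)·2^14 + C(n,4)·2^6 + C(n,3)·2^3 + C(n,2)·2 + n + 1`, and the spanning sets at most `Σ_{j ≤ d} C(n, j)`
(night-1's `ncard_spanning_le`). Here: `64·(Fl(n) + Σ_{j ≤ J} C(n, j)) ≤ 2^n` for `(J, n) = (13, ≥ 58)`, `(18, ≥ 66)`,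
`(22, ≥ 71)`, `(25, ≥ 75)` — the four groups of coranks `d ≤ 13 / 18 / 22 / 25` of the cells `(p, d)`, `p ≥ 52`
(`n = p + d`) — each by `Nat.le_induction` from a decided base (the step: every term at most doubles), and the
`ℚ`-assembly lemma `level_arith64` (night-1's `level_arith` with `7/8` replaced by `63/64`). Axioms: standard.
-/

namespace PercRepro

namespace S2

/-- The flat tail `Fl(n) = C(n,5)·2^14 + C(n,4)·2^6 + C(n,3)·2^3 + C(n,2)·2 + n + 1`. -/
def flatTail (n : ℕ) : ℕ :=
  n.choose 5 * 2 ^ 14 + n.choose 4 * 2 ^ 6 + n.choose 3 * 2 ^ 3 + n.choose 2 * 2 + n + 1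

/-- `C(n+1, r) ≤ 2·C(n, r)` for `r ≤ 5` and `n ≥ 10` (Pascal, `C(n, r−1) ≤ C(n, r)` below the middle). -/
theorem choose_succ_le_two_mul_of_le_five (n r : ℕ) (hn : 10 ≤ n) (hr : r ≤ 5) :
    (n + 1).choose r ≤ 2 * n.choose r := by
  rcases r with _ | r
  · simp
  · rw [Nat.choose_succ_succ']
    have h : n.choose r ≤ n.choose (r + 1) :=
      Nat.choose_le_succ_of_lt_half_left (by omega)
    omega

/-- The flat tail at most doubles from `n` to `n + 1` (`n ≥ 10`). -/
theorem flatTail_succ_le (n : ℕ) (hn : 10 ≤ n) : flatTail (n + 1) ≤ 2 * flatTail n := by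
  unfold flatTail
  have h5 := choose_succ_le_two_mul_of_le_five n 5 hn (by norm_num)
  have h4 := choose_succ_le_two_mul_of_le_five n 4 hn (by norm_num)
  have h3 := choose_succ_le_two_mul_of_le_five n 3 hn (by norm_num)
  have h2 := choose_succ_le_two_mul_of_le_five n 2 hn (by norm_num)
  omega

/-- The combined tail `Fl(n) + Σ_{j ≤ J} C(n, j)` at most doubles from `n` to `n + 1` (`n ≥ 10`). -/
theorem tail_succ_le (n J : ℕ) (hn : 10 ≤ n) :
    flatTail (n + 1) + ∑ j ∈ Finset.range (J + 1), (n + 1).choose j ≤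
      2 * (flatTail n + ∑ j ∈ Finset.range (J + 1), n.choose j) := by
  have h1 := flatTail_succ_le n hn
  have h2 := sum_choose_succ_le_two_mul n J
  omega

/-- **The tail of the cells with `d ≤ 13`**: `64·(Fl(n) + Σ_{j ≤ 13} C(n, j)) ≤ 2^n` for `n ≥ 58`. -/
theorem sixtyfour_mul_tail_thirteen (n : ℕ) (hn : 58 ≤ n) :
    64 * (flatTail n + ∑ j ∈ Finset.range (13 + 1), n.choose j) ≤ 2 ^ n := by
  induction n, hn using Nat.le_induction with
  | base =>
    unfold flatTail
    simp only [Finset.sum_range_succ, Finset.sum_range_zero]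
    norm_num [Nat.choose]
  | succ n hn ih =>
    have h := tail_succ_le n 13 (by omega)
    rw [pow_succ]
    omega

/-- **The tail of the cells with `d ≤ 18`**: `64·(Fl(n) + Σ_{j ≤ 18} C(n, j)) ≤ 2^n` for `n ≥ 66`. -/
theorem sixtyfour_mul_tail_eighteen (n : ℕ) (hn : 66 ≤ n) :
    64 * (flatTail n + ∑ j ∈ Finset.range (18 + 1), n.choose j) ≤ 2 ^ n := by
  induction n, hn using Nat.le_induction with
  | base =>
    unfold flatTail
    simp only [Finset.sum_range_succ, Finset.sum_range_zero]
    norm_num [Nat.choose]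
  | succ n hn ih =>
    have h := tail_succ_le n 18 (by omega)
    rw [pow_succ]
    omega

/-- **The tail of the cells with `d ≤ 22`**: `64·(Fl(n) + Σ_{j ≤ 22} C(n, j)) ≤ 2^n` for `n ≥ 71`. -/
theorem sixtyfour_mul_tail_twentytwo (n : ℕ) (hn : 71 ≤ n) :
    64 * (flatTail n + ∑ j ∈ Finset.range (22 + 1), n.choose j) ≤ 2 ^ n := by
  induction n, hn using Nat.le_induction with
  | base =>
    unfold flatTail
    simp only [Finset.sum_range_succ, Finset.sum_range_zero]
    norm_num [Nat.choose]
  | succ n hn ih =>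
    have h := tail_succ_le n 22 (by omega)
    rw [pow_succ]
    omega

/-- **The tail of the cells with `d ≤ 25`**: `64·(Fl(n) + Σ_{j ≤ 25} C(n, j)) ≤ 2^n` for `n ≥ 75`. -/
theorem sixtyfour_mul_tail_twentyfive (n : ℕ) (hn : 75 ≤ n) :
    64 * (flatTail n + ∑ j ∈ Finset.range (25 + 1), n.choose j) ≤ 2 ^ n := by
  induction n, hn using Nat.le_induction with
  | base =>
    unfold flatTail
    simp only [Finset.sum_range_succ, Finset.sum_range_zero]
    norm_num [Nat.choose]
  | succ n hn ih =>
    have h := tail_succ_le n 25 (by omega)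
    rw [pow_succ]
    omega

/-- **The `63/64` assembly lemma** (night-1's `level_arith` with the tail `64·(A + B) ≤ 2^n`): from
`Φ ≤ 2^(p+q)/C(p+q, q)`, `U ≤ C(p+d, q) + N`, `2^n ≤ Y + A + B`, `64·(A + B) ≤ 2^n` and the polynomial inequality
`64·(C(p+d, q) + N) ≤ 63·2^(d−q)·C(p+q, q)`, conclude `Φ·U ≤ Y`. -/
theorem level_arith64 {p d n q : ℕ} {Φ U Y A B N : ℚ} (hn : n = p + d) (hd : q ≤ d)
    (hΦ : Φ ≤ (2 : ℚ) ^ (p + q) / ((p + q).choose q : ℚ)) (hU0 : 0 ≤ U)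
    (hU : U ≤ ((p + d).choose q : ℚ) + N) (hY : (2 : ℚ) ^ n ≤ Y + A + B) (hAB : 64 * (A + B) ≤ 2 ^ n)
    (hpoly : 64 * (((p + d).choose q : ℚ) + N) ≤ 63 * 2 ^ (d - q) * ((p + q).choose q : ℚ)) : Φ * U ≤ Y := by
  have hc : (0 : ℚ) < ((p + q).choose q : ℚ) := by exact_mod_cast Nat.choose_pos (by omega)
  have hpow : (2 : ℚ) ^ n = 2 ^ (p + q) * 2 ^ (d - q) := by
    rw [← pow_add]; congr 1; omega
  have h1 : Φ * U ≤ (2 : ℚ) ^ (p + q) / ((p + q).choose q : ℚ) * U := mul_le_mul_of_nonneg_right hΦ hU0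
  have h2 : (2 : ℚ) ^ (p + q) / ((p + q).choose q : ℚ) * U ≤
      (2 : ℚ) ^ (p + q) / ((p + q).choose q : ℚ) * (((p + d).choose q : ℚ) + N) :=
    mul_le_mul_of_nonneg_left hU (by positivity)
  have h3 : (2 : ℚ) ^ (p + q) / ((p + q).choose q : ℚ) * (((p + d).choose q : ℚ) + N) ≤
      63 / 64 * 2 ^ n := by
    rw [hpow, div_mul_eq_mul_div, div_le_iff₀ hc]
    have h2p : (0 : ℚ) < 2 ^ (p + q) := by positivity
    calc (2 : ℚ) ^ (p + q) * (((p + d).choose q : ℚ) + N)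
        ≤ 2 ^ (p + q) * (63 / 64 * 2 ^ (d - q) * ((p + q).choose q : ℚ)) := by
          apply mul_le_mul_of_nonneg_left _ h2p.le
          linarith
      _ = 63 / 64 * (2 ^ (p + q) * 2 ^ (d - q)) * ((p + q).choose q : ℚ) := by ring
  have h4 : 63 / 64 * (2 : ℚ) ^ n ≤ Y := by linarith
  linarith

end S2

end PercRepro
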